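import Literature.IUT.LogVolume.Corollary22RatPointDictionary
import Literature.NumberTheory.DiophantineGeometry.GenEllThm21
import HarnessLib

/-!
# R-W task «C:HSHW-REF» (tier 2/3), kit part 4: ADMISSIBILITY at a rational point of the `λ`-line from the dictionary — (P2) and (P5) of
# [IUTchIV] Cor. 2.2 (ii) from a prime factorisation of the denominator of `j(λ)`

PROOF-ONLY file (no `def`, no new `Prop`, no instance, no notation) of the abc-iut cell (seat abc-iut-W-ref-3, gen 0; R-W row «C:HSHW-REF
tier-2/3 (p = 167 [ED], p = 1061, p = 463)»). Classical arithmetic of `ℚ` only; TAKES NO SIDE on [IUTchIII] Cor. 3.12 or on any author.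
With abc-iut-c312-d1's dictionary data at `λ = q ∈ ℚ` — `j(q) = N/∏_{p∈I} p^{e_p}`, `I` primes, `e_p ≥ 1`, `p ∤ N` on `I`
(`Cor22.ord_jInv_ratPoint`, `Cor22.ord_jInv_ratPoint_neg_iff`: the poles of `j(q)` are exactly the places over `I`, `ord = −e_p`):

* `FreyRef.condP2_ratPoint_of_dictionary` — **(P2)** «`l` divides no nonzero local height» ⟸ `l ∤ e_p` for every `p ∈ I`;
* `FreyRef.condP5_ratPoint_of_dictionary` — **(P5)** «a bad place not dividing `2l`» ⟸ some `p₀ ∈ I` with `p₀ ≠ 2`, `p₀ ≠ l`;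
* `FreyRef.ratPoint_triple_mem_UP` — `ratPoint (a/c) ∈ U_P` for an abc triple (abc-iut-S6's `ratPoint_triple_mem`, degree one).

(`AdmitsCore` — `j(q)` avoids the four exceptional values — is checked per point by `norm_num` on the displayed fraction; (P6) is NOT touched.)
[cite: Mochizuki2012, IUTchIV Cor. 2.2 (ii) proof (P2)(P5) p. 45–46] [cite: MochizukiGenEll2010, Def. 3.3 p. 12, Ex. 1.3 (i) p. 5]
[claim: Mochizuki2012, status: disputed] for the IUT sentences quoted.
-/

noncomputable section

namespace Summit.ABC.IUTFork.Conditional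

namespace FreyRef

open NumberField IsDedekindDomain Literature.IUT.LogVolume Literature.IUT.LogVolume.Cor22
open Literature.NumberTheory.DiophantineGeometry Literature.NumberTheory.DiophantineGeometry.GenEll
open Literature.NumberTheory.DiophantineGeometry.UniformABCConjecture Rat.HeightOneSpectrum

variable {q : ℚ} {N D : ℕ} {I : Finset ℕ} {e : ℕ → ℕ}

/-- The prime under the place `primesEquiv⁻¹ p` of `ℚ` is `p`. [folklore] -/
theorem natGenerator_primesEquiv_symm {p : ℕ} (hp : p.Prime) :
    natGenerator ((primesEquiv (R := 𝓞 ℚ)).symm ⟨p, hp⟩) = p :=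
  congrArg Subtype.val ((primesEquiv (R := 𝓞 ℚ)).apply_symm_apply ⟨p, hp⟩)

/-- **(P2) at a rational point from the dictionary**: if `l ∤ e_p` for every `p ∈ I`, then `l` divides no (nonzero, i.e. negative) `ord_v j(q)`
— the poles are the places over `I` and there `ord_v j(q) = −e_{p_v}`. [cite: Mochizuki2012, IUTchIV Cor. 2.2 (ii) proof (P2) p. 45]
[claim: Mochizuki2012, status: disputed] -/
theorem condP2_ratPoint_of_dictionary (hI : ∀ p ∈ I, p.Prime) (he : ∀ p ∈ I, e p ≠ 0) (hD : D = ∏ p ∈ I, p ^ e p)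
    (hj : jInv q = (N : ℚ) / (D : ℚ)) (hN : N ≠ 0) (hcop : ∀ p ∈ I, ¬ p ∣ N) {l : ℕ}
    (hl : ∀ p ∈ I, ¬ l ∣ e p) : CondP2 (ratPoint q) l := by
  -- stated over `ℚ` (the carrier of `ratPoint q` is `ℚ` definitionally)
  have key : ∀ v : HeightOneSpectrum (𝓞 ℚ), ord ℚ v (jInv q) < 0 → ¬ ((l : ℤ) ∣ ord ℚ v (jInv q)) := by
    intro v hv
    have hmem : natGenerator v ∈ I := (ord_jInv_ratPoint_neg_iff hI he hD hj hN v (fun h => hcop _ h)).1 hv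
    rw [ord_jInv_ratPoint_of_mem hI hD hj hN v hmem (hcop _ hmem)]
    intro hdvd
    exact hl _ hmem (by exact_mod_cast (dvd_neg.1 hdvd))
  exact key

/-- **(P5) at a rational point from the dictionary**: a prime `p₀ ∈ I` with `p₀ ≠ 2`, `p₀ ≠ l` gives a place of `ℚ` with `ord j(q) < 0` dividing
neither `2` nor `l`. [cite: Mochizuki2012, IUTchIV Cor. 2.2 (ii) proof (P5) p. 46] [claim: Mochizuki2012, status: disputed] -/
theorem condP5_ratPoint_of_dictionary (hI : ∀ p ∈ I, p.Prime) (he : ∀ p ∈ I, e p ≠ 0) (hD : D = ∏ p ∈ I, p ^ e p)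
    (hj : jInv q = (N : ℚ) / (D : ℚ)) (hN : N ≠ 0) (hcop : ∀ p ∈ I, ¬ p ∣ N) {l p₀ : ℕ} (hl : l.Prime) (hp₀ : p₀ ∈ I)
    (h2 : p₀ ≠ 2) (hpl : p₀ ≠ l) : CondP5 (ratPoint q) l := by
  have hpp : p₀.Prime := hI p₀ hp₀
  -- stated over `ℚ` (the carrier of `ratPoint q` is `ℚ` definitionally)
  have key : ∃ v : HeightOneSpectrum (𝓞 ℚ), ord ℚ v (jInv q) < 0 ∧ ((2 : ℕ) : 𝓞 ℚ) ∉ v.asIdeal ∧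
      ((l : ℕ) : 𝓞 ℚ) ∉ v.asIdeal := by
    set v : HeightOneSpectrum (𝓞 ℚ) := (primesEquiv (R := 𝓞 ℚ)).symm ⟨p₀, hpp⟩ with hvdef
    have hgen : natGenerator v = p₀ := natGenerator_primesEquiv_symm hpp
    refine ⟨v, ?_, ?_, ?_⟩
    · exact (ord_jInv_ratPoint_neg_iff hI he hD hj hN v (fun h => hcop _ h)).2 (by rw [hgen]; exact hp₀)
    · rw [natCast_mem_asIdeal_iff, hgen]
      intro hd
      exact h2 ((Nat.prime_dvd_prime_iff_eq hpp Nat.prime_two).1 hd)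
    · rw [natCast_mem_asIdeal_iff, hgen]
      intro hd
      exact hpl ((Nat.prime_dvd_prime_iff_eq hpp hl).1 hd)
  exact key

/-- **`ratPoint (a/c) ∈ U_P`** for an abc triple `a + b = c` (degree one, `λ ≠ 0, 1`; abc-iut-S6 `ratPoint_triple_mem`).
[cite: MochizukiGenEll2010, Ex. 1.3 (i) p. 5] -/
theorem ratPoint_triple_mem_UP {a b c : ℕ} (h : IsABCTriple a b c) : ratPoint ((a : ℚ) / c) ∈ UP :=
  UPle_subset_UP 1 (ratPoint_triple_mem h)

end FreyRef

end Summit.ABC.IUTFork.Conditional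

end
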